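import Literature.Computability.QuantumComplexity.EffectiveCompilerCodes
import Literature.Computability.QuantumComplexity.UniformSubstitution
import HarnessLib

/-!
# The effective compiler on codes, II: the run, the lookup, the parameters (effective compiler, VI)

Sixth file of the effective gate compiler behind `PromiseBQPOver_eq_PromiseBQP`, completing the
mirror of the program on codes begun in `EffectiveCompilerCodes.lean`:

* **The size invariant** `Sized` of the list program (`Sized.step`, `sized_initSt`, `sized_runL`) and
  the resulting polynomial bound on the code of a state after `r` rounds in ANY context `c`,
  `Sized.code_length_le : |code st| ≤ 200 (|code c| + r + 2ᵐ + 2)⁴` (pointer `≤ r`, `≤ r+1`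
  elements, words of length `≤ r` over indices `< |gens|`, at most `2ᵐ` columns of
  `≤ max 2ᵐ rows` entries clamped by `max |2ᵖ| |B|`) — this is the accumulator bound the loop
  combinator `CodeFP.foldl` asks for, valid on arbitrary (not only genuine) data.
* **The run on codes** `codeFP_runL` (ONE `CodeFP.foldl` over the unit budget; `runL_ctx` identifies
  it with `Params.run`), the initial state `codeFP_initSt` (`initCols` = columns of `2ᵖ • 1`), the
  lookup `codeFP_lookupL` (`lookupL_ctx`), and `codeFP_compileL` (`compileL_ctx : … = Params.compile`).
* **The parameters on codes** for the data of `EffectiveCompiler.lean`: the exponents `qExp`, `tExp`,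
  `rExp` (`= rA·k + rB`), `hExp`, `prec` on unary numerals, the context `codeFP_paramsCtx` and target
  `codeFP_tgtCols` from the names, the unit budget `1^{2^{rExp ⌊log₂ N⌋}}` from `1ᴺ` as a binary power
  capped by the polynomial budget `2^{rB}(N+1)^{rA}` (`codeFP_budget`), whence
  `codeFP_wordIdx` and **`codeFP_rawGates_wordCirc`**: `1ᴺ ↦` the raw gates of
  `wordCirc ⌊log₂ N⌋` is computed on codes — the shape of `GateCompiler.ExpTime`
  (`LogLevelSubstitution.lean`), given that the names are.

Everything is proved; no named facts.

## References

* S. Arora, B. Barak, *Computational Complexity: A Modern Approach*, CUP 2009, §1.3 (closure of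
  polynomial time under composition and polynomially bounded loops) [AroraBarak2009].
* C. M. Dawson, M. A. Nielsen, *The Solovay–Kitaev algorithm*, Quantum Inf. Comput. 6 (2006), §5
  ("the initial net … can be constructed in time polynomial in `1/ε₀`") [DawsonNielsen2006].
-/

noncomputable section

namespace Literature.Computability.QuantumComplexity

open _root_.Computability Complexity Complexity.CodeFP Cryptography GaussianInt Polynomial

namespace NetCompiler

variable {m : ℕ}

/-! ### Sizes of codes -/

/-- A raw code with bounded items is bounded. [folklore] -/
theorem length_rawE_le_of_forall {α : Type} (e : α → List Bool) {l : List α} {b : ℕ}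
    (h : ∀ a ∈ l, (e a).length ≤ b) : (rawE e l).length ≤ l.length * (2 * b + 2) := by
  rw [length_rawE]
  calc (l.map fun a => 2 * (e a).length + 2).sum ≤ (l.map fun a => 2 * (e a).length + 2).length • (2 * b + 2) :=
        List.sum_le_card_nsmul _ _ fun x hx => by
          obtain ⟨a, ha, rfl⟩ := List.mem_map.1 hx
          have := h a ha
          omega
    _ = l.length * (2 * b + 2) := by rw [List.length_map, smul_eq_mul]

/-- The code of an integer of bounded absolute value is short. [folklore] -/
theorem length_intE_le_of_natAbs_le {z : ℤ} {M : ℕ} (h : z.natAbs ≤ M) : (intE z).length ≤ 2 * Nat.size M + 2 := by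
  have h1 := Brick.length_dpEnc_le_two_mul z
  have h2 : (encodeNat z.natAbs).length ≤ Nat.size M := by
    rw [TM2Pass.length_encodeNat_eq_size]; exact Nat.size_le_size h
  change (Brick.dpEnc z).length ≤ _
  omega

/-- The code of a Gaussian integer with bounded components is short. [folklore] -/
theorem length_gE_le {z : GaussianInt} {M : ℕ} (hre : z.re.natAbs ≤ M) (him : z.im.natAbs ≤ M) :
    (gE z).length ≤ 6 * Nat.size M + 10 := by
  rw [gE_apply, pairE_apply, length_boolPair]
  have h1 := length_intE_le_of_natAbs_le hre
  have h2 := length_intE_le_of_natAbs_le him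
  simp only at h1 h2 ⊢
  omega

/-! ### The size invariant of the list program -/

/-- The entry bound of a context: `max |S| |B|` (clamped entries and the scaled identity). [folklore] -/
def Ctx.M (c : Ctx) : ℕ := max c.1.natAbs c.2.1.natAbs

/-- The maximal number of rows of a generator. [folklore] -/
def Ctx.rows (c : Ctx) : ℕ := (c.2.2.2.2.map List.length).foldr max 0

/-- Every generator has at most `rows` rows. [folklore] -/
theorem Ctx.length_le_rows (c : Ctx) {A : List (List GaussianInt)} (hA : A ∈ c.2.2.2.2) : A.length ≤ c.rows := by
  unfold Ctx.rows
  generalize c.2.2.2.2 = L at hA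
  induction L with
  | nil => simp at hA
  | cons B L ih =>
    rw [List.map_cons, List.foldr_cons]
    rcases List.mem_cons.1 hA with rfl | h
    · exact le_max_left _ _
    · exact (ih h).trans (le_max_right _ _)

/-- `rows` is within the code of the context. [folklore] -/
theorem Ctx.rows_le_length (c : Ctx) : c.rows ≤ (Ctx.E c).length := by
  have key : ∀ L : List (List (List GaussianInt)), (L.map List.length).foldr max 0 ≤ (rawE (rawE (rawE gE)) L).length := by
    intro L
    induction L with
    | nil => simp
    | cons A L ih =>
      rw [List.map_cons, List.foldr_cons, rawE_cons, length_boolPair]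
      have := length_le_length_rawE (rawE gE) A
      omega
  obtain ⟨S, B, T2, S2, gens⟩ := c
  simp only [Ctx.rows, pairE_apply, length_boolPair]
  have := key gens
  omega

/-- The number of generators is within the code of the context. [folklore] -/
theorem Ctx.length_gens_le (c : Ctx) : c.2.2.2.2.length ≤ (Ctx.E c).length := by
  obtain ⟨S, B, T2, S2, gens⟩ := c
  simp only [pairE_apply, length_boolPair]
  have := length_le_length_rawE (rawE (rawE gE)) gens
  omega

/-- The entry bound is within the code of the context. [folklore] -/
theorem Ctx.size_M_le (c : Ctx) : Nat.size c.M ≤ (Ctx.E c).length := by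
  obtain ⟨S, B, T2, S2, gens⟩ := c
  simp only [Ctx.M, pairE_apply, length_boolPair]
  have h1 := size_natAbs_le_length_intE S
  have h2 := size_natAbs_le_length_intE B
  rcases le_total S.natAbs B.natAbs with h | h
  · rw [max_eq_right h]; omega
  · rw [max_eq_left h]; omega

/-- **The size invariant** of a list state after `r` rounds in the context `c`: pointer `≤ r`, at
most `r + 1` elements, words of length `≤ r` over indices `< |gens|`, matrices with `≤ 2ᵐ` columns
of `≤ max 2ᵐ rows` entries bounded by `M` in both components. [folklore] -/
structure Sized (m : ℕ) (c : Ctx) (r : ℕ) (st : StL) : Prop where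
  /-- the pointer advanced at most once per round -/
  ptr_le : st.1 ≤ r
  /-- at most one element was appended per round -/
  length_le : st.2.length ≤ r + 1
  /-- words grew by at most one index per round -/
  word_le : ∀ e ∈ st.2, e.1.length ≤ r
  /-- indices come from the range of the generators -/
  idx_lt : ∀ e ∈ st.2, ∀ i ∈ e.1, i < c.2.2.2.2.length
  /-- the number of columns is inherited from the initial matrix -/
  cols_le : ∀ e ∈ st.2, e.2.length ≤ 2 ^ m
  /-- columns have as many entries as a generator has rows (or the initial matrix) -/
  col_le : ∀ e ∈ st.2, ∀ col ∈ e.2, col.length ≤ max (2 ^ m) c.rows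
  /-- entries are clamped (or are `2ᵖ`, `0` initially) -/
  entry_le : ∀ e ∈ st.2, ∀ col ∈ e.2, ∀ z ∈ col, z.re.natAbs ≤ c.M ∧ z.im.natAbs ≤ c.M

/-- Clamped values are bounded by `|B|` whatever the sign of `B`. [folklore] -/
theorem natAbs_clampZ_le (B a : ℤ) : (clampZ B a).natAbs ≤ B.natAbs := by
  unfold clampZ
  rcases le_total 0 B with h | h <;> omega

/-- **A candidate is well sized.** [folklore] -/
theorem sized_candL (c : Ctx) (Xc : List (List GaussianInt)) (i : ℕ) :
    (candL c Xc i).length = Xc.length ∧ (∀ col ∈ candL c Xc i, col.length ≤ c.rows) ∧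
      ∀ col ∈ candL c Xc i, ∀ z ∈ col, z.re.natAbs ≤ c.M ∧ z.im.natAbs ≤ c.M := by
  refine ⟨by simp [candL, clampL, roundMulL], fun col hcol => ?_, fun col hcol z hz => ?_⟩
  · simp only [candL, clampL, roundMulL, List.map_map, List.mem_map] at hcol
    obtain ⟨x, -, rfl⟩ := hcol
    simp only [Function.comp_apply, List.length_map]
    rcases lt_or_ge i c.2.2.2.2.length with hi | hi
    · rw [List.getD_eq_getElem _ _ hi]; exact c.length_le_rows (List.getElem_mem hi)
    · rw [List.getD_eq_default _ _ hi]; simp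
  · simp only [candL, clampL, List.mem_map] at hcol
    obtain ⟨col', -, rfl⟩ := hcol
    obtain ⟨z', -, rfl⟩ := List.mem_map.1 hz
    exact ⟨(natAbs_clampZ_le _ _).trans (le_max_right _ _), (natAbs_clampZ_le _ _).trans (le_max_right _ _)⟩

/-- **The size invariant is preserved by a round.** [folklore] -/
theorem Sized.step {c : Ctx} {r : ℕ} {st : StL} (h : Sized m c r st) : Sized m c (r + 1) (stepL m c st) := by
  obtain ⟨ptr, net⟩ := st
  have hmono : Sized m c (r + 1) (ptr, net) :=
    { ptr_le := Nat.le_succ_of_le h.ptr_le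
      length_le := Nat.le_succ_of_le h.length_le
      word_le := fun e he => Nat.le_succ_of_le (h.word_le e he)
      idx_lt := h.idx_lt
      cols_le := h.cols_le
      col_le := h.col_le
      entry_le := h.entry_le }
  unfold stepL
  dsimp only
  split_ifs with hlt
  · set e := net.getD ptr ([], zeroCols m) with he_def
    have he_mem : e ∈ net := by rw [he_def, List.getD_eq_getElem _ _ hlt]; exact List.getElem_mem hlt
    rcases hfc : farCandsL c net e with _ | ⟨x, xs⟩
    · dsimp only
      exact { hmono with ptr_le := Nat.succ_le_succ h.ptr_le }
    · dsimp only
      have hx : x ∈ farCandsL c net e := by rw [hfc]; exact List.mem_cons_self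
      simp only [farCandsL, List.mem_filter, List.mem_map, List.mem_range] at hx
      obtain ⟨⟨i, hi, rfl⟩, -⟩ := hx
      obtain ⟨hlenc, hcolc, hentc⟩ := sized_candL c e.2 i
      have aux : ∀ {P : ElemL → Prop}, (∀ e' ∈ net, P e') → P (e.1 ++ [i], candL c e.2 i) →
          ∀ e' ∈ net ++ [(e.1 ++ [i], candL c e.2 i)], P e' := fun hP hnew e' he' => by
        rw [List.mem_append, List.mem_singleton] at he'
        rcases he' with he' | rfl
        · exact hP e' he'
        · exact hnew
      exact
        { ptr_le := Nat.le_succ_of_le h.ptr_le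
          length_le := by rw [List.length_append, List.length_singleton]; exact Nat.succ_le_succ h.length_le
          word_le := aux (fun e' he' => Nat.le_succ_of_le (h.word_le e' he'))
            (by rw [List.length_append, List.length_singleton]; exact Nat.succ_le_succ (h.word_le e he_mem))
          idx_lt := aux h.idx_lt fun j hj => by
            rw [List.mem_append, List.mem_singleton] at hj
            rcases hj with hj | rfl
            · exact h.idx_lt e he_mem j hj
            · exact hi
          cols_le := aux h.cols_le (by rw [hlenc]; exact h.cols_le e he_mem)
          col_le := aux h.col_le fun col hcol => (hcolc col hcol).trans (le_max_right _ _)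
          entry_le := aux h.entry_le hentc }
  · exact hmono

/-- **The length of the code of a well-sized state** is polynomial:
`|code st| ≤ 200 n⁴` for `n = |code c| + r + 2ᵐ + 2`. [folklore] -/
theorem Sized.code_length_le {c : Ctx} {r : ℕ} {st : StL} (h : Sized m c r st) :
    (StL.E st).length ≤ 200 * ((Ctx.E c).length + r + 2 ^ m + 2) ^ 4 := by
  have h2m : 1 ≤ 2 ^ m := Nat.one_le_two_pow
  set d := 2 ^ m with hd
  set n := (Ctx.E c).length + r + d + 2 with hn
  have hC : (Ctx.E c).length ≤ n := by omega
  have hr : r + 1 ≤ n := by omega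
  have hm : d ≤ n := by omega
  have hrows : max (2 ^ m) c.rows ≤ n := max_le hm (c.rows_le_length.trans hC)
  have hM : Nat.size c.M ≤ n := c.size_M_le.trans hC
  have hgens : c.2.2.2.2.length ≤ n := c.length_gens_le.trans hC
  have hn1 : 1 ≤ n := by omega
  -- entries, columns, matrices, words, elements
  have hentry : ∀ e ∈ st.2, ∀ col ∈ e.2, ∀ z ∈ col, (gE z).length ≤ 6 * n + 10 := fun e he col hcol z hz => by
    obtain ⟨h1, h2⟩ := h.entry_le e he col hcol z hz
    exact (length_gE_le h1 h2).trans (by omega)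
  have hcol : ∀ e ∈ st.2, ∀ col ∈ e.2, (rawE gE col).length ≤ n * (12 * n + 22) := fun e he col hcol =>
    (length_rawE_le_of_forall gE (hentry e he col hcol)).trans
      (Nat.mul_le_mul ((h.col_le e he col hcol).trans hrows) (by omega))
  have hmat : ∀ e ∈ st.2, (rawE (rawE gE) e.2).length ≤ n * (2 * (n * (12 * n + 22)) + 2) := fun e he =>
    (length_rawE_le_of_forall (rawE gE) (hcol e he)).trans (Nat.mul_le_mul ((h.cols_le e he).trans hm) le_rfl)
  have hword : ∀ e ∈ st.2, (rawE natE e.1).length ≤ n * (2 * n + 2) := fun e he =>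
    (length_rawE_le_of_forall natE (b := n) fun i hi =>
      (length_natE_le i).trans ((h.idx_lt e he i hi).le.trans hgens)).trans
      (Nat.mul_le_mul ((h.word_le e he).trans (by omega)) le_rfl)
  have helem : ∀ e ∈ st.2, (ElemL.E e).length ≤ 80 * n ^ 3 := fun e he => by
    show (pairE (rawE natE) (rawE (rawE gE)) e).length ≤ _
    rw [pairE_apply, length_boolPair]
    have h1 := hword e he
    have h2 := hmat e he
    have h3 : n * (2 * n + 2) ≤ 4 * n ^ 3 := by nlinarith
    have h4 : n * (2 * (n * (12 * n + 22)) + 2) ≤ 70 * n ^ 3 := by nlinarith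
    nlinarith
  have hnet : (rawE ElemL.E st.2).length ≤ n * (2 * (80 * n ^ 3) + 2) :=
    (length_rawE_le_of_forall ElemL.E helem).trans (Nat.mul_le_mul (h.length_le.trans hr) le_rfl)
  have hptr : (natE st.1).length ≤ n := (length_natE_le _).trans (h.ptr_le.trans (by omega))
  show (pairE natE (rawE ElemL.E) st).length ≤ _
  rw [pairE_apply, length_boolPair]
  have hn4 : n ≤ n ^ 4 := Nat.le_self_pow (by norm_num) n
  have h5 : n * (2 * (80 * n ^ 3) + 2) ≤ 162 * n ^ 4 := by
    have : n * (2 * (80 * n ^ 3) + 2) = 160 * n ^ 4 + 2 * n := by ring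
    omega
  have h6 : 2 * n + 2 ≤ 4 * n ^ 4 := by omega
  omega


/-! ### Tabulating over a constant list -/

/-- A list of maps computed on codes, tabulated over a constant list of indices. [folklore] -/
theorem codeFP_mapConst {ι α β : Type} {eα : α → List Bool} {e : β → List Bool} {f : α → ι → β}
    (hf : ∀ i, CodeFP eα e fun a => f a i) (l : List ι) : CodeFP eα (rawE e) fun a => l.map (f a) := by
  induction l with
  | nil => exact CodeFP.const eα []
  | cons i l ih => exact ((rawCons e).comp ((hf i).pair ih)).congr fun _ => rfl

/-! ### The initial state -/

/-- The column list of the scaled identity `S • 1`. [folklore] -/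
def initCols (m : ℕ) (S : ℤ) : List (List GaussianInt) :=
  (qregList m).map fun j => (qregList m).map fun i => if i = j then ((S : GaussianInt)) else 0

/-- `initCols` is the column list of `Params.one`. [folklore] -/
theorem initCols_ctx (P : Params m) : initCols m P.ctx.1 = colsOf P.one := by
  simp only [initCols, colsOf, Params.ctx, Params.one, Matrix.smul_apply, Matrix.one_apply, smul_eq_mul, mul_ite,
    mul_one, mul_zero, Int.cast_natCast]

/-- The initial list state of a context. [folklore] -/
def initSt (m : ℕ) (c : Ctx) : StL := (0, [([], initCols m c.1)])

/-- `initSt` is the list form of `Params.init`. [folklore] -/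
theorem initSt_ctx (P : Params m) : initSt m P.ctx = encSt P.init := by
  simp only [initSt, encSt, Params.init, List.map_cons, List.map_nil, encElem, initCols_ctx]

/-- The enumeration has `2ᵐ` labels. [folklore] -/
theorem length_qregList (m : ℕ) : (qregList m).length = 2 ^ m := by
  rw [qregList, Finset.length_toList, Finset.card_univ, card_QReg_eq]

/-- The initial state is well sized. [folklore] -/
theorem sized_initSt (c : Ctx) : Sized m c 0 (initSt m c) where
  ptr_le := le_rfl
  length_le := by simp [initSt]
  word_le e he := by obtain rfl : e = ([], initCols m c.1) := List.mem_singleton.1 he; simp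
  idx_lt e he i hi := by obtain rfl : e = ([], initCols m c.1) := List.mem_singleton.1 he; simp at hi
  cols_le e he := by
    obtain rfl : e = ([], initCols m c.1) := List.mem_singleton.1 he
    simp [initCols, length_qregList]
  col_le e he col hcol := by
    obtain rfl : e = ([], initCols m c.1) := List.mem_singleton.1 he
    simp only [initCols, List.mem_map] at hcol
    obtain ⟨j, -, rfl⟩ := hcol
    rw [List.length_map, length_qregList]; exact le_max_left _ _
  entry_le e he col hcol z hz := by
    obtain rfl : e = ([], initCols m c.1) := List.mem_singleton.1 he
    simp only [initCols, List.mem_map] at hcol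
    obtain ⟨j, -, rfl⟩ := hcol
    obtain ⟨i, -, rfl⟩ := List.mem_map.1 hz
    split_ifs
    · simp [Ctx.M]
    · simp

/-- `initCols` on codes. [folklore] -/
theorem codeFP_initCols (m : ℕ) : CodeFP intE (rawE (rawE gE)) (initCols m) := by
  unfold initCols
  refine codeFP_mapConst (fun j => codeFP_mapConst (fun i => ?_) _) _
  by_cases hij : i = j
  · exact ((codeFP_gmk' (CodeFP.id intE) (CodeFP.const intE (0 : ℤ))).congr fun S => by
      rw [if_pos hij]; rfl)
  · exact (CodeFP.const intE (0 : GaussianInt)).congr fun S => by rw [if_neg hij]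

/-- `initSt` on codes. [folklore] -/
theorem codeFP_initSt (m : ℕ) : CodeFP Ctx.E StL.E (initSt m) := by
  have hS : CodeFP Ctx.E intE fun c : Ctx => c.1 := fst _ _
  have hcols : CodeFP Ctx.E (rawE (rawE gE)) fun c : Ctx => initCols m c.1 := ((codeFP_initCols m).comp hS).congr fun _ => rfl
  have helem : CodeFP Ctx.E ElemL.E fun c : Ctx => (([] : List ℕ), initCols m c.1) := (CodeFP.const _ ([] : List ℕ)).pair hcols
  have hnet : CodeFP Ctx.E (rawE ElemL.E) fun c : Ctx => [(([] : List ℕ), initCols m c.1)] := ((rawSingleton _).comp helem).congr fun _ => rfl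
  exact ((CodeFP.const _ (0 : ℕ)).pair hnet).congr fun _ => rfl

/-! ### The run -/

/-- **The run on lists**: fold the rounds over a unit budget. [folklore] -/
def runL (m : ℕ) (c : Ctx) (u : List Unit) : StL := u.foldl (fun st _ => stepL m c st) (initSt m c)

/-- `runL` is the list form of `Params.run`. [folklore] -/
theorem runL_ctx (P : Params m) (R : ℕ) : runL m P.ctx (List.replicate R ()) = encSt (P.run R) := by
  induction R with
  | zero => exact initSt_ctx P
  | succ R ih =>
    rw [runL, List.replicate_succ', List.foldl_append, List.foldl_cons, List.foldl_nil] at *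
    rw [ih, stepL_ctx, Params.run_succ]

/-- The run is well sized. [folklore] -/
theorem sized_runL (c : Ctx) (u : List Unit) : Sized m c u.length (runL m c u) := by
  induction u using List.reverseRecOn with
  | nil => exact sized_initSt c
  | append_singleton u x ih =>
    rw [runL, List.foldl_append, List.foldl_cons, List.foldl_nil, List.length_append, List.length_singleton]
    exact ih.step

/-- **The run on codes** (one `CodeFP.foldl` over the unit budget; the accumulator bound is the size
invariant `Sized.code_length_le`). [cite: AroraBarak2009, §1.3 (polynomially bounded loops)] -/
theorem codeFP_runL (m : ℕ) : CodeFP (pairE Ctx.E (rawE unitE)) StL.E fun p : Ctx × List Unit => runL m p.1 p.2 := by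
  have hstep : CodeFP (pairE Ctx.E (pairE unitE StL.E)) StL.E fun t : Ctx × (Unit × StL) => stepL m t.1 t.2.2 :=
    ((codeFP_stepL m).comp ((fst _ _).pair (snd _ _).snd')).congr fun _ => rfl
  have h := CodeFP.foldl (σ := Ctx) (α := Unit) (β := StL) (eσ := Ctx.E) (eα := unitE) (eβ := StL.E)
    (step := fun c _ st => stepL m c st) (init := initSt m) hstep (codeFP_initSt m)
    (200 * (X + Polynomial.C (2 ^ m + 2)) ^ 4) (fun c l₁ l₂ => by
      have hs := (sized_runL (m := m) c l₁).code_length_le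
      rw [runL] at hs
      refine hs.trans ?_
      simp only [eval_mul, eval_pow, eval_add, eval_X, eval_C, eval_ofNat, pairE_apply, length_boolPair]
      apply Nat.mul_le_mul_left
      apply Nat.pow_le_pow_left
      have := length_le_length_rawE unitE (l₁ ++ l₂)
      rw [List.length_append] at this
      omega)
  exact h.congr fun p => rfl

/-! ### The lookup -/

/-- The lookup on lists: the word of the first element passing the test (empty if none). [folklore] -/
def lookupL (TT2 S2 : ℤ) (net : List ElemL) (tgtC : List (List GaussianInt)) : List ℕ :=
  (((net.filter fun e => closeTestL TT2 S2 tgtC e.2).map Prod.fst).headD [])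

/-- `Params.lookup` as a head with default. [folklore] -/
theorem Params.lookup_eq_headD (P : Params m) (TT : ℕ) (net : List (Elem m)) (tgt : GMat m) :
    P.lookup TT net tgt = (((net.filter fun e => closeTest P.p TT tgt e.2).map Prod.fst).headD []) := by
  rw [Params.lookup]
  rcases hl : net.filter (fun e => closeTest P.p TT tgt e.2) with _ | ⟨e, es⟩
  · rw [hl]; rfl
  · rw [hl]; rfl

/-- `lookupL` is the list form of `Params.lookup`. [folklore] -/
theorem lookupL_ctx (P : Params m) (TT : ℕ) (net : List (Elem m)) (tgt : GMat m) :
    lookupL ((TT : ℤ) ^ 2) (4 ^ P.p) (net.map encElem) (colsOf tgt) = P.lookup TT net tgt := by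
  rw [lookupL, P.lookup_eq_headD, List.filter_map, List.map_map]
  have hf : (net.filter ((fun e : ElemL => closeTestL ((TT : ℤ) ^ 2) (4 ^ P.p) (colsOf tgt) e.2) ∘ encElem)) =
      net.filter fun e => closeTest P.p TT tgt e.2 :=
    List.filter_congr fun e _ => by simp only [Function.comp_apply, encElem, closeTestL_colsOf]
  rw [hf]
  rfl

/-- `lookupL` on codes. [folklore] -/
theorem codeFP_lookupL : CodeFP (pairE (pairE intE intE) (pairE (rawE ElemL.E) (rawE (rawE gE)))) (rawE natE)
    fun p : (ℤ × ℤ) × (List ElemL × List (List GaussianInt)) => lookupL p.1.1 p.1.2 p.2.1 p.2.2 := by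
  -- the filter: context `(TT2, S2, tgtC)`, items `e`
  have htest : CodeFP (pairE (pairE (pairE intE intE) (rawE (rawE gE))) ElemL.E) bitE
      fun t : ((ℤ × ℤ) × List (List GaussianInt)) × ElemL => closeTestL t.1.1.1 t.1.1.2 t.1.2 t.2.2 :=
    (codeFP_closeTestL.comp ((fst _ _).fst'.pair ((fst _ _).snd'.pair (snd _ _).snd'))).congr fun _ => rfl
  have hfil : CodeFP (pairE (pairE intE intE) (pairE (rawE ElemL.E) (rawE (rawE gE)))) (rawE ElemL.E)
      fun p : (ℤ × ℤ) × (List ElemL × List (List GaussianInt)) => p.2.1.filter fun e => closeTestL p.1.1 p.1.2 p.2.2 e.2 :=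
    ((filter htest).comp (((fst _ _).pair (snd _ _).snd').pair (snd _ _).fst')).congr fun _ => rfl
  have hwords : CodeFP (pairE (pairE intE intE) (pairE (rawE ElemL.E) (rawE (rawE gE)))) (rawE (rawE natE))
      fun p : (ℤ × ℤ) × (List ElemL × List (List GaussianInt)) =>
        (p.2.1.filter fun e => closeTestL p.1.1 p.1.2 p.2.2 e.2).map Prod.fst :=
    ((map₀ (fst (rawE natE) (rawE (rawE gE)))).comp hfil).congr fun _ => rfl
  exact ((rawHeadD (rawE natE) (d := ([] : List ℕ)) rfl).comp hwords).congr fun _ => rfl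

/-- **The compiled index word on lists**: run, then look up. [folklore] -/
def compileL (m : ℕ) (c : Ctx) (TT2 : ℤ) (u : List Unit) (tgtC : List (List GaussianInt)) : List ℕ :=
  lookupL TT2 c.2.2.2.1 (runL m c u).2 tgtC

/-- `compileL` is `Params.compile`. [folklore] -/
theorem compileL_ctx (P : Params m) (R TT : ℕ) (tgt : GMat m) :
    compileL m P.ctx ((TT : ℤ) ^ 2) (List.replicate R ()) (colsOf tgt) = P.compile R TT tgt := by
  rw [compileL, runL_ctx, Params.compile]
  exact lookupL_ctx P TT (P.run R).2 tgt

/-- `compileL` on codes. [folklore] -/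
theorem codeFP_compileL (m : ℕ) :
    CodeFP (pairE Ctx.E (pairE intE (pairE (rawE unitE) (rawE (rawE gE))))) (rawE natE)
      fun p : Ctx × (ℤ × (List Unit × List (List GaussianInt))) => compileL m p.1 p.2.1 p.2.2.1 p.2.2.2 := by
  have hrun : CodeFP (pairE Ctx.E (pairE intE (pairE (rawE unitE) (rawE (rawE gE))))) StL.E
      fun p : Ctx × (ℤ × (List Unit × List (List GaussianInt))) => runL m p.1 p.2.2.1 :=
    ((codeFP_runL m).comp ((fst _ _).pair (snd _ _).snd'.fst')).congr fun _ => rfl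
  have hS2 : CodeFP (pairE Ctx.E (pairE intE (pairE (rawE unitE) (rawE (rawE gE))))) intE
      fun p : Ctx × (ℤ × (List Unit × List (List GaussianInt))) => p.1.2.2.2.1 := (fst _ _).snd'.snd'.snd'.fst'
  exact (codeFP_lookupL.comp (((snd _ _).fst'.pair hS2).pair (hrun.snd'.pair (snd _ _).snd'.snd'))).congr fun _ => rfl


/-! ### The parameters on codes -/

/-- Multiplication of a unary numeral by a constant (iterated `unAdd`). [folklore] -/
theorem codeFP_unMulConst : ∀ c : ℕ, CodeFP unE unE fun n => c * n
  | 0 => (CodeFP.const unE 0).congr fun n => by simp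
  | c + 1 => (unAdd.comp ((codeFP_unMulConst c).pair (CodeFP.id unE))).congr fun n => by
      simp only [id]; ring

namespace Data

variable {G : QGateSet} (D : Data G m)

/-- The slope of `rExp` in `k`. [folklore] -/
def rA : ℕ := (1 + D.cc) * (2 * (2 ^ m * 2 ^ m))

/-- The offset of `rExp`. [folklore] -/
def rB : ℕ := (7 + 2 * m + D.cQ + 3 * D.cc + m * D.cc) * (2 * (2 ^ m * 2 ^ m)) + 1

/-- `rExp k = rA · k + rB`. [folklore] -/
theorem rExp_eq (k : ℕ) : D.rExp k = D.rA * k + D.rB := by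
  simp only [rExp, pbExp, tExp, qExp, rA, rB]; ring

/-- `qExp` on unary codes. [folklore] -/
theorem codeFP_qExp : CodeFP unE unE D.qExp := by
  have h1 : CodeFP unE unE fun k => 3 + m + k := (unAdd.comp ((CodeFP.const _ (3 + m)).pair (CodeFP.id unE))).congr fun _ => rfl
  have h2 : CodeFP unE unE fun k => D.cc * (3 + m + k) := ((codeFP_unMulConst D.cc).comp h1).congr fun _ => rfl
  exact (unAdd.comp ((CodeFP.const _ D.cQ).pair h2)).congr fun _ => rfl

/-- `tExp` on unary codes. [folklore] -/
theorem codeFP_tExp : CodeFP unE unE D.tExp := by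
  have h1 : CodeFP unE unE fun k => 4 + k := (unAdd.comp ((CodeFP.const _ 4).pair (CodeFP.id unE))).congr fun _ => rfl
  exact (unAdd.comp (h1.pair D.codeFP_qExp)).congr fun _ => rfl

/-- `rExp` on unary codes. [folklore] -/
theorem codeFP_rExp : CodeFP unE unE D.rExp := by
  have h1 : CodeFP unE unE fun k => D.rA * k := (codeFP_unMulConst D.rA).congr fun _ => rfl
  exact (unAdd.comp (h1.pair (CodeFP.const _ D.rB))).congr fun k => by simp only [rExp_eq]

/-- `hExp` on unary codes. [folklore] -/
theorem codeFP_hExp : CodeFP unE unE D.hExp :=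
  (unAdd.comp ((CodeFP.const _ (4 + m)).pair D.codeFP_rExp)).congr fun _ => rfl

/-- `prec` on unary codes. [folklore] -/
theorem codeFP_prec : CodeFP unE unE D.prec := by
  have h1 : CodeFP unE unE fun k => 1 + m + D.tExp k := (unAdd.comp ((CodeFP.const _ (1 + m)).pair D.codeFP_tExp)).congr fun _ => rfl
  exact (unAdd.comp (h1.pair D.codeFP_hExp)).congr fun _ => rfl

/-- `2ᵖ` as an integer, on codes. [folklore] -/
theorem codeFP_twoPowPrec : CodeFP unE intE fun k => ((2 ^ D.prec k : ℕ) : ℤ) :=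
  (intOfNat.comp (natPow.comp ((CodeFP.const _ 2).pair D.codeFP_prec))).congr fun _ => rfl

/-- The generator rows at level `k` on codes, from the names. [folklore] -/
theorem codeFP_gensRows (hg : ∀ (i : ℕ) (x y : QReg m), CodeFP unE gE fun p => D.gname i x y p) :
    CodeFP unE (rawE (rawE (rawE gE))) fun k => (D.gens k).map rowsOf := by
  have hentry : ∀ (i : ℕ) (x y : QReg m), CodeFP unE gE fun k => D.gname i x y (D.prec k) := fun i x y =>
    ((hg i x y).comp D.codeFP_prec).congr fun _ => rfl
  have hrows : ∀ i : ℕ, CodeFP unE (rawE (rawE gE)) fun k => rowsOf (D.genMat k i) := fun i =>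
    (codeFP_mapConst (fun x => codeFP_mapConst (fun y => hentry i x y) (qregList m)) (qregList m)).congr fun k => by
      simp [rowsOf, genMat]
  exact (codeFP_mapConst hrows (List.range D.pl.length)).congr fun k => by simp [gens, List.map_map]

/-- The target columns at level `k` on codes, from the names. [folklore] -/
theorem codeFP_tgtCols (ht : ∀ x y : QReg m, CodeFP unE gE fun p => D.tname x y p) :
    CodeFP unE (rawE (rawE gE)) fun k => colsOf (D.tgt k) := by
  have hentry : ∀ x y : QReg m, CodeFP unE gE fun k => D.tname x y (D.prec k) := fun x y =>
    ((ht x y).comp D.codeFP_prec).congr fun _ => rfl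
  exact (codeFP_mapConst (fun j => codeFP_mapConst (fun i => hentry i j) (qregList m)) (qregList m)).congr fun k => by
    simp [colsOf, tgt]

/-- **The context of level `k` on codes.** [folklore] -/
theorem codeFP_paramsCtx (hg : ∀ (i : ℕ) (x y : QReg m), CodeFP unE gE fun p => D.gname i x y p) :
    CodeFP unE Ctx.E fun k => (D.params k).ctx := by
  have hS := D.codeFP_twoPowPrec
  have hB : CodeFP unE intE fun k => ((2 ^ m + 1 : ℕ) : ℤ) * ((2 ^ D.prec k : ℕ) : ℤ) :=
    (intMul.comp ((CodeFP.const _ (((2 ^ m + 1 : ℕ) : ℤ))).pair hS)).congr fun _ => rfl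
  have hT : CodeFP unE intE fun k => ((2 ^ D.tExp k : ℕ) : ℤ) :=
    (intOfNat.comp (natPow.comp ((CodeFP.const _ 2).pair D.codeFP_tExp))).congr fun _ => rfl
  have hT2 : CodeFP unE intE fun k => ((2 ^ D.tExp k : ℕ) : ℤ) * ((2 ^ D.tExp k : ℕ) : ℤ) := (intMul.comp (hT.pair hT)).congr fun _ => rfl
  have hS2 : CodeFP unE intE fun k => ((4 ^ D.prec k : ℕ) : ℤ) :=
    (intOfNat.comp (natPow.comp ((CodeFP.const _ 4).pair D.codeFP_prec))).congr fun _ => rfl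
  exact (hS.pair (hB.pair (hT2.pair (hS2.pair (D.codeFP_gensRows hg))))).congr fun k => by
    simp only [Params.ctx, params_p, params_T, params_gens, Params.B, card_QReg_eq]
    push_cast
    ring_nf

/-- The unit budget `1^{2^{rExp k}}` from the unary input `1ᴺ` with `k = ⌊log₂ N⌋`: computed as a
binary power capped by the polynomial budget `2^{rB} (N + 1)^{rA} ≥ 2^{rExp k}`. [cite: AroraBarak2009, §1.3] -/
theorem codeFP_budget : CodeFP unE (rawE unitE) fun N => List.replicate (2 ^ D.rExp (Nat.log 2 N)) () := by
  have hlog : CodeFP unE natE fun N => Nat.log 2 N :=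
    (natLog2Min.comp (natOfUn.pair replicateUnit)).congr fun N => by
      simp only [id, List.length_replicate]; exact min_eq_right (Nat.log_le_self 2 N)
  have hkU : CodeFP unE unE fun N => Nat.log 2 N :=
    (unOfNatMin.comp ((CodeFP.id unE).pair hlog)).congr fun N => min_eq_left (Nat.log_le_self 2 N)
  have hR : CodeFP unE natE fun N => 2 ^ D.rExp (Nat.log 2 N) :=
    (natPow.comp ((CodeFP.const _ 2).pair (D.codeFP_rExp.comp hkU))).congr fun _ => rfl
  have hbig : CodeFP unE (rawE unitE) fun N => List.replicate (2 ^ D.rB * (N + 1) ^ D.rA) () :=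
    (unitsMul.comp ((replicateUnit.comp (CodeFP.const unE (2 ^ D.rB))).pair ((unitsPow D.rA).comp unSucc))).congr fun N => by
      simp only [List.length_replicate]
  refine (unitsOfNatMin.comp (hbig.pair hR)).congr fun N => ?_
  simp only [List.length_replicate]
  congr 1
  refine min_eq_left ?_
  rw [rExp_eq, pow_add, pow_mul', mul_comm]
  refine Nat.mul_le_mul_left _ (Nat.pow_le_pow_left ?_ _)
  rcases Nat.eq_zero_or_pos N with rfl | hN
  · simp
  · exact (Nat.pow_log_le_self 2 hN.ne').trans (Nat.le_succ N)

/-- **The compiled index word from the unary input.** [folklore] -/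
theorem codeFP_wordIdx (hg : ∀ (i : ℕ) (x y : QReg m), CodeFP unE gE fun p => D.gname i x y p)
    (ht : ∀ x y : QReg m, CodeFP unE gE fun p => D.tname x y p) :
    CodeFP unE (rawE natE) fun N => D.wordIdx (Nat.log 2 N) := by
  have hlog : CodeFP unE natE fun N => Nat.log 2 N :=
    (natLog2Min.comp (natOfUn.pair replicateUnit)).congr fun N => by
      simp only [id, List.length_replicate]; exact min_eq_right (Nat.log_le_self 2 N)
  have hkU : CodeFP unE unE fun N => Nat.log 2 N :=
    (unOfNatMin.comp ((CodeFP.id unE).pair hlog)).congr fun N => min_eq_left (Nat.log_le_self 2 N)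
  have hctx : CodeFP unE Ctx.E fun N => (D.params (Nat.log 2 N)).ctx := ((D.codeFP_paramsCtx hg).comp hkU).congr fun _ => rfl
  have htgt : CodeFP unE (rawE (rawE gE)) fun N => colsOf (D.tgt (Nat.log 2 N)) := ((D.codeFP_tgtCols ht).comp hkU).congr fun _ => rfl
  have hTT2 : CodeFP unE intE fun N => (((2 ^ (Nat.log 2 N + 1) : ℕ) : ℤ)) ^ 2 :=
    (intOfNat.comp (natPow.comp ((CodeFP.const _ 4).pair (unSucc.comp hkU)))).congr fun N => by
      push_cast; rw [← pow_mul, mul_comm, pow_mul]; norm_num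
  have hc := ((codeFP_compileL m).comp (hctx.pair (hTT2.pair (D.codeFP_budget.pair htgt)))).congr fun _ => rfl
  exact hc.congr fun N => by
    simp only []
    rw [wordIdx, rounds, ← compileL_ctx]

variable [Encodable G.Op]

/-- The table of raw gates of the generators. [folklore] -/
def gateTable : List RawGate := D.pl.map fun q => (QGate.gate q.1 q.2 : QGate G m).toRaw

/-- The raw gate of the default placement. [folklore] -/
def dfltRaw : RawGate := (QGate.gate D.dflt.1 D.dflt.2 : QGate G m).toRaw

/-- The raw gate of generator `i` is the table entry. [folklore] -/
theorem toRaw_gateOf (i : ℕ) : (D.gateOf i).toRaw = D.gateTable.getD i D.dfltRaw := by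
  rw [gateTable, dfltRaw, List.getD_map]; rfl

/-- The raw gates of the compiled circuit. [folklore] -/
theorem rawGates_wordCirc (k : ℕ) : (D.wordCirc k).rawGates = (D.wordIdx k).map fun i => D.gateTable.getD i D.dfltRaw := by
  simp only [QCircuit.rawGates, wordCirc, List.map_map]
  exact List.map_congr_left fun i _ => D.toRaw_gateOf i

/-- **The effective compiler is exponential-time**: the raw gates of the compiled circuit of level
`⌊log₂ N⌋` are computed on codes from `1ᴺ`, provided the names of the generator and target entries
are (the shape of `GateCompiler.ExpTime`). [cite: AroraBarak2009, §1.3] [cite: DawsonNielsen2006, §5] -/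
theorem codeFP_rawGates_wordCirc (hg : ∀ (i : ℕ) (x y : QReg m), CodeFP unE gE fun p => D.gname i x y p)
    (ht : ∀ x y : QReg m, CodeFP unE gE fun p => D.tname x y p) :
    CodeFP unE (rawE RawGate.E) fun N => (D.wordCirc (Nat.log 2 N)).rawGates := by
  have hitem : CodeFP (pairE unitE natE) RawGate.E fun t : Unit × ℕ => D.gateTable.getD t.2 D.dfltRaw :=
    ((rawGetOr RawGate.E).comp ((CodeFP.const _ D.gateTable).pair ((snd _ _).pair (CodeFP.const _ D.dfltRaw)))).congr fun _ => rfl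
  exact (((map hitem).comp ((CodeFP.const _ ()).pair (D.codeFP_wordIdx hg ht))).congr fun N => by
    rw [rawGates_wordCirc])

end Data

end NetCompiler

end Literature.Computability.QuantumComplexity

end
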